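import Mathlib.Data.Fintype.Perm
import Summits.QuantumFields.YangMills.Theorems.SmallCircleAnchorAnchorGapTreeWeightPeeling

/-!
# Crux `AnchorGap` (stmt-QuantumFields-11141), line `registered` — stub TREESUM, part 2: re-rooting
# and labelling

Continuation of `SmallCircleAnchorAnchorGapTreeWeightPeeling.lean` ([folklore]; no definition, no
named fact):

* §3 `sum_forests_le_reroot` — RE-ROOTING IS FREE: the lines `{i, t i}` of a parent map rooted at
  `r` are the edges of its graph `SimpleGraph.fromRel (t · = ·)`, a tree
  (`SpanningTreeParentMap.isTree_fromRel`); every tree is the graph of a parent map towards any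
  vertex (`exists_isForestOn_of_isTree`), determined by root and graph (`eq_of_fromRel_eq`); so a
  sum over the labelled trees rooted at `ρ` of a nonnegative function of the line product is at
  most the same sum over the labelled trees rooted at `r₀`.
* §4 transport along an enumeration `e : Fin (m+1) → β` of a polymer `X` (`isForestOn_conj`,
  `prod_sdiff_eq_prod_conj`, `eq_of_conj_eq`), the `(n−1)!` enumerations with the pinned point at
  label `0` (`exists_embed`), and the LABELLED BOUND `sum_labelled_le`: summing
  `∏_{i ≠ ρ} y {e i, e (τ i)}` over root labels `ρ`, labelled trees `τ` rooted at `ρ` and positions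
  `e` with `e 0 = b` gives at most `(m+1) · (m+1)^{m−1} · Y^m` (re-root at `0`, peel, Cayley's
  formula `card_forests_univ_singleton`).
-/

set_option autoImplicit false

namespace Summit.QuantumFields.YangMills.Theorems.AnchorGap.TreeSum

open Finset Function Literature.Combinatorics.Enumerative Literature.Probability.LatticeModels

/-! ### §3 Labelled trees: the lines of a parent map are the edges of its graph; re-rooting -/

section Reroot

variable {V : Type} [Fintype V] [DecidableEq V]

/-- The lines `{i, t i}` (`i ≠ r`) of a parent map rooted at `r` are exactly the edges of its
graph `SimpleGraph.fromRel (t · = ·)`. [folklore] -/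
theorem mem_image_line_iff_adj {r : V} {t : V → V} (ht : IsForestOn (univ : Finset V) {r} t)
    (a c : V) :
    s(a, c) ∈ (univ \ {r}).image (fun i => s(i, t i)) ↔
      (SimpleGraph.fromRel fun x y => t x = y).Adj a c := by
  rw [SimpleGraph.fromRel_adj, mem_image]
  constructor
  · rintro ⟨i, hi, h⟩
    have hne : t i ≠ i := apply_ne_self_of_mem_sdiff ht hi
    rcases Sym2.eq_iff.1 h with ⟨rfl, rfl⟩ | ⟨rfl, rfl⟩
    · exact ⟨hne.symm, Or.inl rfl⟩
    · exact ⟨hne, Or.inr rfl⟩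
  · rintro ⟨hne, h | h⟩
    · refine ⟨a, ?_, by rw [h]⟩
      rw [mem_sdiff, mem_singleton]
      refine ⟨mem_univ _, fun har => hne ?_⟩
      rw [← h, har, ht.apply_of_mem_roots (mem_singleton_self r)]
    · refine ⟨c, ?_, by rw [h, Sym2.eq_swap]⟩
      rw [mem_sdiff, mem_singleton]
      refine ⟨mem_univ _, fun hcr => hne ?_⟩
      rw [← h, hcr, ht.apply_of_mem_roots (mem_singleton_self r)]

/-- Parent maps with the same graph have the same lines (whatever their roots). [folklore] -/
theorem image_line_eq_of_fromRel_eq {r r' : V} {t t' : V → V}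
    (ht : IsForestOn (univ : Finset V) {r} t) (ht' : IsForestOn (univ : Finset V) {r'} t')
    (heq : (SimpleGraph.fromRel fun x y => t x = y) = SimpleGraph.fromRel fun x y => t' x = y) :
    (univ \ {r}).image (fun i => s(i, t i)) = (univ \ {r'}).image (fun i => s(i, t' i)) := by
  ext ℓ
  induction ℓ using Sym2.ind with
  | h a c => rw [mem_image_line_iff_adj ht, mem_image_line_iff_adj ht', heq]

/-- The line product of a labelled tree depends only on its graph, not on the root. [folklore] -/
theorem prod_line_eq_of_fromRel_eq {r r' : V} {t t' : V → V}
    (ht : IsForestOn (univ : Finset V) {r} t) (ht' : IsForestOn (univ : Finset V) {r'} t')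
    (heq : (SimpleGraph.fromRel fun x y => t x = y) = SimpleGraph.fromRel fun x y => t' x = y)
    (f : Sym2 V → ℝ) :
    ∏ i ∈ univ \ {r}, f s(i, t i) = ∏ i ∈ univ \ {r'}, f s(i, t' i) := by
  rw [← prod_image_line ht f, ← prod_image_line ht' f, image_line_eq_of_fromRel_eq ht ht' heq]

/-- **Re-rooting.** A labelled tree (parent map rooted at `r`) can be re-rooted at any vertex
`r'` keeping its graph: the graph is a tree (`SpanningTreeParentMap.isTree_fromRel`) and every
tree is the graph of a parent map towards any of its vertices
(`SpanningTreeParentMap.exists_isForestOn_of_isTree`). [folklore] -/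
theorem exists_reroot {r : V} {t : V → V} (ht : IsForestOn (univ : Finset V) {r} t) (r' : V) :
    ∃ t' : V → V, IsForestOn (univ : Finset V) {r'} t' ∧
      (SimpleGraph.fromRel fun x y => t' x = y) = SimpleGraph.fromRel fun x y => t x = y :=
  Literature.Combinatorics.SimpleGraph.SpanningTreeParentMap.exists_isForestOn_of_isTree
    (Literature.Combinatorics.SimpleGraph.SpanningTreeParentMap.isTree_fromRel ht) r'

variable {β : Type}

/-- **Moving the root costs nothing.** For positions `e ∈ E` and symmetric pair weights `y ≥ 0`,
the sum over the labelled trees rooted at `ρ` of `Σ_e ∏_{i ≠ ρ} y {e i, e (τ i)}` is at most the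
same sum over the labelled trees rooted at `r₀` (re-root each tree; the line product is a product
over the edges of the common graph; re-rooting is injective by
`SpanningTreeParentMap.eq_of_fromRel_eq`). [folklore] -/
theorem sum_forests_le_reroot {y : Sym2 β → ℝ} (hy : ∀ ℓ, 0 ≤ y ℓ) (ρ r₀ : V)
    (E : Finset (V → β)) :
    ∑ τ ∈ forests (univ : Finset V) {ρ}, ∑ e ∈ E, ∏ i ∈ univ \ {ρ}, y s(e i, e (τ i))
      ≤ ∑ τ' ∈ forests (univ : Finset V) {r₀}, ∑ e ∈ E, ∏ i ∈ univ \ {r₀}, y s(e i, e (τ' i)) := by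
  classical
  have hex : ∀ τ : forests (univ : Finset V) {ρ}, ∃ t' : V → V,
      IsForestOn (univ : Finset V) {r₀} t' ∧
        (SimpleGraph.fromRel fun x y => t' x = y) = SimpleGraph.fromRel fun x y => (τ : V → V) x = y :=
    fun τ => exists_reroot (mem_forests.1 τ.2) r₀
  choose R hR using hex
  have hinj : Function.Injective R := by
    intro τ τ' h
    apply Subtype.ext
    exact Literature.Combinatorics.SimpleGraph.SpanningTreeParentMap.eq_of_fromRel_eq
      (mem_forests.1 τ.2) (mem_forests.1 τ'.2) (by rw [← (hR τ).2, ← (hR τ').2, h])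
  -- the summand is invariant under re-rooting
  have hsame : ∀ τ : forests (univ : Finset V) {ρ}, ∀ e : V → β,
      ∏ i ∈ univ \ {ρ}, y s(e i, e ((τ : V → V) i)) = ∏ i ∈ univ \ {r₀}, y s(e i, e (R τ i)) := by
    intro τ e
    have key := prod_line_eq_of_fromRel_eq (hR τ).1 (mem_forests.1 τ.2) (hR τ).2
      (fun ℓ => y (ℓ.map e))
    simp only [Sym2.map_mk] at key
    exact key.symm
  calc ∑ τ ∈ forests (univ : Finset V) {ρ}, ∑ e ∈ E, ∏ i ∈ univ \ {ρ}, y s(e i, e (τ i))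
      = ∑ τ : forests (univ : Finset V) {ρ}, ∑ e ∈ E, ∏ i ∈ univ \ {r₀}, y s(e i, e (R τ i)) := by
        rw [← Finset.sum_coe_sort]
        exact Finset.sum_congr rfl fun τ _ => Finset.sum_congr rfl fun e _ => hsame τ e
    _ = ∑ τ' ∈ Finset.univ.image R, ∑ e ∈ E, ∏ i ∈ univ \ {r₀}, y s(e i, e (τ' i)) := by
        rw [Finset.sum_image fun τ _ τ' _ h => hinj h]
    _ ≤ ∑ τ' ∈ forests (univ : Finset V) {r₀}, ∑ e ∈ E, ∏ i ∈ univ \ {r₀}, y s(e i, e (τ' i)) := by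
        refine Finset.sum_le_sum_of_subset_of_nonneg ?_ fun τ' _ _ =>
          sum_nonneg fun e _ => prod_nonneg fun _ _ => hy _
        intro τ' hτ'
        obtain ⟨τ, -, rfl⟩ := Finset.mem_image.1 hτ'
        exact mem_forests.2 (hR τ).1

end Reroot

/-! ### §4 Labelling a polymer by `Fin (m+1)`: transport, enumerations, the labelled bound -/

section Label

variable {β : Type} [DecidableEq β] {m : ℕ} {e : Fin (m + 1) → β} {X : Finset β} {r : β}
  {t : β → β} {τ : Fin (m + 1) → Fin (m + 1)} {ρ : Fin (m + 1)}

/-- Every point of `X` is enumerated. [folklore] -/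
theorem exists_index_of_mem (hX : Finset.univ.image e = X) {v : β} (hv : v ∈ X) : ∃ i, e i = v := by
  rw [← hX, mem_image] at hv
  obtain ⟨i, -, hi⟩ := hv
  exact ⟨i, hi⟩

/-- Enumerated points lie in `X`. [folklore] -/
theorem apply_mem_of_image_eq (hX : Finset.univ.image e = X) (i : Fin (m + 1)) : e i ∈ X := by
  rw [← hX]; exact Finset.mem_image_of_mem _ (mem_univ i)

/-- A parent map on `X` TRANSPORTS to the labels: some `τ` with `e (τ i) = t (e i)`. [folklore] -/
theorem exists_conj (hX : Finset.univ.image e = X) (hr : r ∈ X) (ht : IsForestOn X {r} t) :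
    ∃ τ : Fin (m + 1) → Fin (m + 1), ∀ i, e (τ i) = t (e i) := by
  have h : ∀ i, ∃ j, e j = t (e i) := fun i =>
    exists_index_of_mem hX (ht.apply_mem (singleton_subset_iff.2 hr) (apply_mem_of_image_eq hX i))
  exact ⟨fun i => (h i).choose, fun i => (h i).choose_spec⟩

omit [DecidableEq β] in
/-- Iterates transport. [folklore] -/
theorem apply_conj_iterate (hτ : ∀ i, e (τ i) = t (e i)) (k : ℕ) (i : Fin (m + 1)) :
    e (τ^[k] i) = t^[k] (e i) := by
  induction k with
  | zero => rfl
  | succ k ih => rw [Function.iterate_succ_apply', Function.iterate_succ_apply', hτ, ih]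

/-- The transported parent map is a tree on the labels rooted at the label of the root.
[folklore] -/
theorem isForestOn_conj (he : Function.Injective e) (hX : Finset.univ.image e = X)
    (ht : IsForestOn X {r} t) (hτ : ∀ i, e (τ i) = t (e i)) (hρ : e ρ = r) :
    IsForestOn (univ : Finset (Fin (m + 1))) {ρ} τ := by
  refine ⟨fun v hv => ?_, fun v _ => ?_⟩
  · have hv0 : v = ρ := by simpa using hv
    subst hv0
    apply he
    rw [hτ, hρ, ht.apply_of_mem_roots (mem_singleton_self r)]
  · obtain ⟨k, hk⟩ := ht.2 (e v) (apply_mem_of_image_eq hX v)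
    refine ⟨k, mem_singleton.2 (he ?_)⟩
    rw [apply_conj_iterate hτ, hρ]
    exact mem_singleton.1 hk

/-- The line product transports to the labels. [folklore] -/
theorem prod_sdiff_eq_prod_conj (he : Function.Injective e) (hX : Finset.univ.image e = X)
    (hτ : ∀ i, e (τ i) = t (e i)) (hρ : e ρ = r) (f : Sym2 β → ℝ) :
    ∏ u ∈ X \ {r}, f s(u, t u)
      = ∏ i ∈ (univ : Finset (Fin (m + 1))) \ {ρ}, f s(e i, e (τ i)) := by
  have hset : X \ {r} = ((univ : Finset (Fin (m + 1))) \ {ρ}).image e := by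
    rw [← hX]
    ext v
    simp only [mem_sdiff, mem_image, mem_univ, true_and, mem_singleton]
    constructor
    · rintro ⟨⟨j, rfl⟩, hne⟩
      exact ⟨j, fun hj => hne (by rw [hj, hρ]), rfl⟩
    · rintro ⟨j, hj, rfl⟩
      exact ⟨⟨j, rfl⟩, fun h => hj (he (by rw [h, hρ]))⟩
  rw [hset, prod_image (fun a _ b _ h => he h)]
  exact prod_congr rfl (fun i _ => by rw [hτ])

/-- The enumeration and the transported tree determine the tree. [folklore] -/
theorem eq_of_conj_eq {t' : β → β} (hX : Finset.univ.image e = X)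
    (ht : IsForestOn X {r} t) (ht' : IsForestOn X {r} t') (hτ : ∀ i, e (τ i) = t (e i))
    (hτ' : ∀ i, e (τ i) = t' (e i)) : t = t' := by
  funext v
  by_cases hv : v ∈ X
  · obtain ⟨i, rfl⟩ := exists_index_of_mem hX hv
    rw [← hτ, ← hτ']
  · rw [ht.apply_of_not_mem hv, ht'.apply_of_not_mem hv]

/-- **The `(n−1)!` enumerations of a polymer with the pinned point at label `0`.** There is a rule
`E` assigning to every `X ∋ b` with `m + 1` points and every permutation `π` of `Fin m` an
injective enumeration `E X π : Fin (m+1) → β` of `X` with `E X π 0 = b`, different permutations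
giving different enumerations (label `j + 1 ↦` the `π j`-th point of `X ∖ {b}` in a fixed
enumeration `Finset.equivFinOfCardEq`). [folklore] -/
theorem exists_embed (b : β) (m : ℕ) :
    ∃ E : Finset β → Equiv.Perm (Fin m) → Fin (m + 1) → β, ∀ X : Finset β, b ∈ X → X.card = m + 1 →
      ∀ π : Equiv.Perm (Fin m), E X π 0 = b ∧ Function.Injective (E X π) ∧
        Finset.univ.image (E X π) = X ∧ ∀ π' : Equiv.Perm (Fin m), E X π = E X π' → π = π' := by
  classical
  -- a fixed enumeration of `X \ {b}` (junk `b` when the cardinality is wrong)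
  let en : Finset β → Fin m → β := fun X =>
    if h : (X.erase b).card = m then fun j => ((Finset.equivFinOfCardEq h).symm j : β) else fun _ => b
  refine ⟨fun X π => Fin.cases b (fun j => en X (π j)), fun X hb hcard π => ?_⟩
  have hc : (X.erase b).card = m := by rw [card_erase_of_mem hb, hcard]; rfl
  have hen : en X = fun j => ((Finset.equivFinOfCardEq hc).symm j : β) := by
    simp only [en, dif_pos hc]
  have en_mem : ∀ j, en X j ∈ X.erase b := fun j => by
    rw [hen]; exact ((Finset.equivFinOfCardEq hc).symm j).2
  have en_inj : Function.Injective (en X) := by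
    rw [hen]; intro i j hij
    exact (Finset.equivFinOfCardEq hc).symm.injective (Subtype.ext hij)
  have en_surj : ∀ v ∈ X.erase b, ∃ j, en X j = v := fun v hv => by
    rw [hen]; exact ⟨Finset.equivFinOfCardEq hc ⟨v, hv⟩, by simp⟩
  refine ⟨rfl, ?_, ?_, ?_⟩
  · intro i j hij
    dsimp only at hij
    induction i using Fin.cases with
    | zero =>
      induction j using Fin.cases with
      | zero => rfl
      | succ j =>
        exfalso; simp only [Fin.cases_zero, Fin.cases_succ] at hij
        exact (notMem_erase b X) (hij ▸ en_mem (π j))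
    | succ i =>
      induction j using Fin.cases with
      | zero =>
        exfalso; simp only [Fin.cases_zero, Fin.cases_succ] at hij
        exact (notMem_erase b X) (hij ▸ en_mem (π i))
      | succ j =>
        simp only [Fin.cases_succ] at hij
        rw [π.injective (en_inj hij)]
  · ext v
    simp only [mem_image, mem_univ, true_and]
    constructor
    · rintro ⟨i, rfl⟩
      induction i using Fin.cases with
      | zero => exact hb
      | succ j => simp only [Fin.cases_succ]; exact mem_of_mem_erase (en_mem (π j))
    · intro hv
      by_cases hvb : v = b
      · exact ⟨0, by simp only [Fin.cases_zero, hvb]⟩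
      · obtain ⟨j, hj⟩ := en_surj v (mem_erase.2 ⟨hvb, hv⟩)
        exact ⟨(π.symm j).succ, by simp only [Fin.cases_succ, Equiv.apply_symm_apply, hj]⟩
  · intro π' hππ
    apply Equiv.ext
    intro j
    have := congr_fun hππ j.succ
    simp only [Fin.cases_succ] at this
    exact en_inj this

end Label

section Labelled

variable {β : Type} [Fintype β]

/-- **The labelled bound.** For symmetric pair weights `y ≥ 0` with row sums `≤ Y`: summing
`∏_{i ≠ ρ} y {e i, e (τ i)}` over the root labels `ρ : Fin (m+1)`, the labelled trees `τ` rooted at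
`ρ` and the positions `e : Fin (m+1) → β` with `e 0 = b` gives at most
`(m+1) · (m+1)^{m−1} · Y^m` — re-root each tree at `0` (§3), peel the leaves (§2), and count the
trees rooted at `0` by Cayley's formula (`card_forests_univ_singleton`). [folklore] -/
theorem sum_labelled_le {y : Sym2 β → ℝ} (hy : ∀ ℓ, 0 ≤ y ℓ) {Y : ℝ}
    (hY : ∀ a : β, ∑ a', y s(a, a') ≤ Y) (b : β) (m : ℕ) :
    ∑ z ∈ (univ : Finset (Fin (m + 1))).sigma (fun ρ =>
        forests (univ : Finset (Fin (m + 1))) {ρ} ×ˢ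
          Fintype.piFinset (fun i => if i ∈ (univ : Finset (Fin (m + 1))) \ {0}
            then (univ : Finset β) else {b})),
      ∏ i ∈ (univ : Finset (Fin (m + 1))) \ {z.1}, y s(z.2.2 i, z.2.2 (z.2.1 i))
      ≤ ((m + 1 : ℕ) : ℝ) * (((m + 1 : ℕ) : ℝ) ^ (m - 1) * Y ^ m) := by
  rw [sum_sigma]
  set P := Fintype.piFinset (fun i => if i ∈ (univ : Finset (Fin (m + 1))) \ {0}
    then (univ : Finset β) else {b}) with hP
  -- per root label ρ
  have hρ : ∀ ρ : Fin (m + 1),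
      ∑ q ∈ forests (univ : Finset (Fin (m + 1))) {ρ} ×ˢ P,
          ∏ i ∈ (univ : Finset (Fin (m + 1))) \ {ρ}, y s(q.2 i, q.2 (q.1 i))
        ≤ ((m + 1 : ℕ) : ℝ) ^ (m - 1) * Y ^ m := by
    intro ρ
    rw [sum_product]
    refine le_trans (sum_forests_le_reroot hy ρ 0 _) ?_
    calc ∑ τ' ∈ forests (univ : Finset (Fin (m + 1))) {0}, ∑ e ∈ P,
            ∏ i ∈ (univ : Finset (Fin (m + 1))) \ {0}, y s(e i, e (τ' i))
        ≤ ∑ τ' ∈ forests (univ : Finset (Fin (m + 1))) {0}, Y ^ m := by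
          refine sum_le_sum (fun τ' hτ' => ?_)
          refine sum_pos_prod_le hy hY b m univ {0} τ' ?_ (subset_univ _) (mem_forests.1 hτ')
          rw [Finset.card_univ_sdiff, card_singleton, Fintype.card_fin]; rfl
      _ = ((m + 1 : ℕ) : ℝ) ^ (m - 1) * Y ^ m := by
          rw [sum_const, nsmul_eq_mul, card_forests_univ_singleton, Fintype.card_fin]
          push_cast
          congr 1
  calc ∑ ρ : Fin (m + 1), ∑ q ∈ forests (univ : Finset (Fin (m + 1))) {ρ} ×ˢ P,
          ∏ i ∈ (univ : Finset (Fin (m + 1))) \ {ρ}, y s(q.2 i, q.2 (q.1 i))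
      ≤ ∑ ρ : Fin (m + 1), ((m + 1 : ℕ) : ℝ) ^ (m - 1) * Y ^ m := sum_le_sum (fun ρ _ => hρ ρ)
    _ = ((m + 1 : ℕ) : ℝ) * (((m + 1 : ℕ) : ℝ) ^ (m - 1) * Y ^ m) := by
        rw [sum_const, card_univ, Fintype.card_fin, nsmul_eq_mul]

end Labelled

end Summit.QuantumFields.YangMills.Theorems.AnchorGap.TreeSum
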